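import Summits.QuantumFields.YangMills.Theorems.ContinuumLimitOnTrajectory.Negative.UltralocalNoLimit

/-!
# `ContinuumLimitOnTrajectory` — negative-side support V: rigidity of witnesses (what the species
# renormalisation can and cannot do)

Support file for crux `stmt-QuantumFields-10522` ((A) of `ParabolicTrajectory`), extracted from §4 of the
standing disprover's work file `Cruxes/ContinuumLimitOnTrajectory/Disproof.lean` (cdisprove gen 3). Tree objects
only (`smearedLatticeField`, `latticeSchwinger`, `IsYangMillsFor`, `OSData`); nothing is posited.

* `smearedLatticeField_affine`: `Φ_{c,m}(f) = c Φ_{1,0}(f) - c m a⁴ ∑ f(a x)`; `cov`, `cov_affine`.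
* `unitField`, `twoPointKernel`: the unit-normalised connected lattice two-point kernel `K_{a,β,L}(u, v)` of
  `tr F²` — a function of the BARE data `(a, β, L)` alone; `latticeSchwinger_conn_two_eq`:
  `⟨Φ(u)Φ(v)⟩_k - ⟨Φ(u)⟩_k⟨Φ(v)⟩_k = c_k² K_k(u, v)` along every scheme (the additive counterterm `m_k` is
  invisible in connected functions; `c_k` enters squared).
* `S2T`, `exists_truncated_ne_zero_of_isNontrivial`: `IsNontrivial` is witnessed by a REAL time-separated pair.
* `tendsto_c_sq_mul_kernel` (`c_k² K_k(u,v) → 𝔖₂ᵀ(u ⊗ v)` under `IsYangMillsFor`),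
  `eventually_c_ne_zero_and_kernel_ne_zero`, `tendsto_kernel_ratio` (WITNESS-FREE: kernel ratios converge),
  `truncated_two_unique_up_to_scale`, `scale_ne_zero`: two OS data tied to schemes with the same bare data have
  PROPORTIONAL truncated two-point functions of `tr F²` on `⁰𝒮` — the `∃ T` of the crux is unique up to field
  rescaling on the sector the lattice pins, and `c_k` is determined up to sign and `o(1)` by the bare sequence.
-/

namespace Summit.QuantumFields.YangMills.Theorems.ContinuumLimitOnTrajectory.Negative

open MeasureTheory Filter Topology Complex
open scoped SchwartzMap ComplexConjugate
open Literature.MathematicalPhysics.QuantumFieldTheory Literature.MathematicalPhysics.QuantumLattice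
open Literature.MathematicalPhysics.AQFT (IsOffDiagonal coincidenceLocus)
open Literature.Probability.LatticeModels (box)

noncomputable section


section Affine

variable {G : Type} [MeasurableSpace G]

/-- **The smeared field is affine in the renormalisation constants**:
`Φ_{c,m}(f) = c · Φ_{1,0}(f) - c m a⁴ ∑_{x ∈ Λ} f(a x)`. [folklore] -/
theorem smearedLatticeField_affine (O : LGConfig 4 G → ℝ)
    (Λ : Finset (Literature.Probability.LatticeModels.Site 4)) (a c m : ℝ) (f : 𝓢((EuclideanSpace ℝ (Fin 4)), ℝ))
    (U : LGConfig 4 G) :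
    smearedLatticeField O Λ a c m f U =
      c * smearedLatticeField O Λ a 1 0 f U - c * m * a ^ 4 * ∑ x ∈ Λ, f (a • siteToE x) := by
  simp only [smearedLatticeField, Finset.mul_sum, one_mul, sub_zero]
  rw [← Finset.sum_sub_distrib]
  exact Finset.sum_congr rfl fun x _ => by ring

end Affine

section Covariance

variable {Ω : Type*} [MeasurableSpace Ω] (μ : Measure Ω) [IsProbabilityMeasure μ]

/-- The covariance of two real random variables (connected two-point function). [folklore] -/
def cov (X Y : Ω → ℝ) : ℝ := (∫ ω, X ω * Y ω ∂μ) - (∫ ω, X ω ∂μ) * ∫ ω, Y ω ∂μ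

/-- **Affine maps act on covariances by `c²`; the shifts drop out.** [folklore] -/
theorem cov_affine {X Y : Ω → ℝ} (hX : Integrable X μ) (hY : Integrable Y μ)
    (hXY : Integrable (fun ω => X ω * Y ω) μ) (c d d' : ℝ) :
    cov μ (fun ω => c * X ω + d) (fun ω => c * Y ω + d') = c ^ 2 * cov μ X Y := by
  unfold cov
  have h1 : ∀ ω, (c * X ω + d) * (c * Y ω + d') =
      c ^ 2 * (X ω * Y ω) + c * d' * X ω + c * d * Y ω + d * d' := fun ω => by ring
  simp_rw [h1]
  rw [integral_add, integral_add, integral_add, integral_const_mul, integral_const_mul,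
    integral_const_mul, integral_const, integral_add, integral_const_mul, integral_const,
    integral_add, integral_const_mul, integral_const]
  · simp only [probReal_univ, one_smul]
    ring
  · exact hY.const_mul c
  · exact integrable_const _
  · exact hX.const_mul c
  · exact integrable_const _
  · exact hXY.const_mul _
  · exact hX.const_mul _
  · exact (hXY.const_mul _).add (hX.const_mul _)
  · exact hY.const_mul _
  · exact ((hXY.const_mul _).add (hX.const_mul _)).add (hY.const_mul _)
  · exact integrable_const _

/-- The same with subtractive shifts. [folklore] -/
theorem cov_affine_sub {X Y : Ω → ℝ} (hX : Integrable X μ) (hY : Integrable Y μ)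
    (hXY : Integrable (fun ω => X ω * Y ω) μ) (c e e' : ℝ) :
    cov μ (fun ω => c * X ω - e) (fun ω => c * Y ω - e') = c ^ 2 * cov μ X Y := by
  simp only [sub_eq_add_neg]
  exact cov_affine μ hX hY hXY c (-e) (-e')

end Covariance

section Kernel

variable {G : Type} [Group G] [TopologicalSpace G] [IsTopologicalGroup G] [CompactSpace G]
  [MeasurableSpace G] [BorelSpace G] {N : ℕ}

/-- Continuous functions of the torus gauge field are integrable for Wilson's measure (a
probability measure; `G` is second countable through the faithful representation `r`). [folklore] -/
theorem integrable_wilson (r : LatticeRep G) {S : ℕ} [NeZero S] (β : ℝ) {F : GaugeConfig 4 S G → ℝ}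
    (hF : Continuous F) : Integrable F (wilsonMeasure (d := 4) (L := S) r.ρ β) := by
  haveI : SecondCountableTopology G :=
    (r.continuous.isClosedEmbedding r.injective).isEmbedding.secondCountableTopology
  haveI := isProbabilityMeasure_wilsonMeasure (d := 4) (L := S) r.ρ r.continuous β
  obtain ⟨C, hC⟩ := isCompact_univ.exists_bound_of_continuousOn hF.continuousOn
  exact Integrable.of_bound hF.aestronglyMeasurable C (ae_of_all _ fun x => hC x (Set.mem_univ x))

/-- **The unit-normalised smeared curvature field** `Φ_{1,0}(f)` (`c = 1`, `m = 0`) on the torus of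
side `2L+1` at spacing `a`, as a function of the torus configuration. [folklore] -/
def unitField (ρ : G →* Matrix (Fin N) (Fin N) ℂ) (a : ℝ) (L : ℕ) (f : 𝓢((EuclideanSpace ℝ (Fin 4)), ℝ))
    (U : GaugeConfig 4 (2 * L + 1) G) : ℝ :=
  smearedLatticeField (actionDensity ρ) (box 4 L) a 1 0 f (torusLift (2 * L + 1) U)

/-- **The unit-normalised connected two-point kernel** of the lattice curvature field,
`K_{a,β,L}(u, v) = ⟨Φ_{1,0}(u) Φ_{1,0}(v)⟩ - ⟨Φ_{1,0}(u)⟩⟨Φ_{1,0}(v)⟩` under Wilson's measure at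
coupling `β` on the torus of side `2L+1`: a function of the bare data `(a, β, L)` ALONE — no
renormalisation constant enters. [folklore] -/
def twoPointKernel (ρ : G →* Matrix (Fin N) (Fin N) ℂ) (a β : ℝ) (L : ℕ) (u v : 𝓢((EuclideanSpace ℝ (Fin 4)), ℝ)) : ℝ :=
  cov (wilsonMeasure (d := 4) (L := 2 * L + 1) ρ β) (unitField ρ a L u) (unitField ρ a L v)

omit [CompactSpace G] [BorelSpace G] in
/-- The unit-normalised field is a continuous function of the torus configuration. [folklore] -/
theorem continuous_unitField {ρ : G →* Matrix (Fin N) (Fin N) ℂ} (hρ : Continuous ρ) (a : ℝ) (L : ℕ)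
    (f : 𝓢((EuclideanSpace ℝ (Fin 4)), ℝ)) : Continuous (unitField ρ a L f) := by
  unfold unitField
  simp only [smearedLatticeField_torusLift]
  exact continuous_const.mul (continuous_finsetSum _ fun x _ =>
    continuous_const.mul ((continuous_torusDensity ρ hρ _ _).sub continuous_const))

/-- **`m`-invisibility and `c²`-scaling.** Along ANY scheme, the connected lattice two-point
function of the renormalised curvature field is `c_k²` times the unit-normalised kernel at the
scheme's bare data `(a_k, β_k, L_k)`; the additive counterterm `m_k` does not enter. [folklore] -/
theorem latticeSchwinger_conn_two_eq (r : LatticeRep G) (sch : SpeciesScheme (YMSpecies G)) (k : ℕ)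
    (u v : 𝓢((EuclideanSpace ℝ (Fin 4)), ℝ)) :
    latticeSchwinger r.ρ sch (fun s => s.F) k (1 + 1) (fun _ => r.curvature) ![u, v] -
        latticeSchwinger r.ρ sch (fun s => s.F) k 1 (fun _ => r.curvature) ![u] *
          latticeSchwinger r.ρ sch (fun s => s.F) k 1 (fun _ => r.curvature) ![v] =
      (sch.c r.curvature k) ^ 2 * twoPointKernel r.ρ (sch.a k) (sch.β k) (sch.L k) u v := by
  haveI := isProbabilityMeasure_wilsonMeasure (d := 4) (L := sch.side k) r.ρ r.continuous (sch.β k)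
  rw [latticeSchwinger_two, latticeSchwinger_one, latticeSchwinger_one]
  set e : 𝓢((EuclideanSpace ℝ (Fin 4)), ℝ) → ℝ := fun f => sch.c r.curvature k * sch.m r.curvature k * sch.a k ^ 4 *
      ∑ x ∈ box 4 (sch.L k), f (sch.a k • siteToE x) with he
  have hΦ : ∀ (f : 𝓢((EuclideanSpace ℝ (Fin 4)), ℝ)) (U : GaugeConfig 4 (sch.side k) G),
      smearedLatticeField (actionDensity r.ρ) (box 4 (sch.L k)) (sch.a k) (sch.c r.curvature k)
        (sch.m r.curvature k) f (torusLift (sch.side k) U) =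
      sch.c r.curvature k * unitField r.ρ (sch.a k) (sch.L k) f U - e f := fun f U => by
    rw [smearedLatticeField_affine]; rfl
  simp_rw [hΦ]
  have hu := continuous_unitField (ρ := r.ρ) r.continuous (sch.a k) (sch.L k) u
  have hv := continuous_unitField (ρ := r.ρ) r.continuous (sch.a k) (sch.L k) v
  exact cov_affine_sub (wilsonMeasure (d := 4) (L := sch.side k) r.ρ (sch.β k))
    (X := unitField r.ρ (sch.a k) (sch.L k) u) (Y := unitField r.ρ (sch.a k) (sch.L k) v)
    (integrable_wilson r _ hu) (integrable_wilson r _ hv)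
    (integrable_wilson r _ (hu.mul hv)) (sch.c r.curvature k) (e u) (e v)

/-- The kernel depends on the scheme only through `(a, β, L)`. [folklore] -/
theorem twoPointKernel_congr {sch sch' : SpeciesScheme (YMSpecies G)} (ha : sch'.a = sch.a)
    (hβ : sch'.β = sch.β) (hL : sch'.L = sch.L) (ρ : G →* Matrix (Fin N) (Fin N) ℂ) (k : ℕ)
    (u v : 𝓢((EuclideanSpace ℝ (Fin 4)), ℝ)) :
    twoPointKernel ρ (sch'.a k) (sch'.β k) (sch'.L k) u v =
      twoPointKernel ρ (sch.a k) (sch.β k) (sch.L k) u v := by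
  rw [ha, hβ, hL]

end Kernel

section Truncated

open Literature.MathematicalPhysics.AQFT (IsOffDiagonal coincidenceLocus)

variable {ι : Type}

/-- The truncated (connected) continuum two-point function of the species `s` of the OS datum
`T` on the real product tensor `u ⊗ v`. [folklore] -/
def S2T (T : OSData ι 4) (s : ι) (u v : 𝓢((EuclideanSpace ℝ (Fin 4)), ℝ)) : ℂ :=
  T.schwinger (1 + 1) (fun _ => s) (T2 u v) -
    T.schwinger 1 (fun _ => s) (T1 u) * T.schwinger 1 (fun _ => s) (T1 v)

/-- **Non-triviality is witnessed by a REAL time-separated pair.** If `T.IsNontrivial s` then some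
real test functions `u` (negative times) and `v` (positive times) have non-vanishing truncated
two-point function `𝔖₂ᵀ(u ⊗ v) ≠ 0`. (Decompose the complex witness `Θ F̄ ⊗ G` into four real
time-separated product tensors.) [folklore] -/
theorem exists_truncated_ne_zero_of_isNontrivial (T : OSData ι 4) (s : ι) (hT : T.IsNontrivial s) :
    ∃ u v : 𝓢((EuclideanSpace ℝ (Fin 4)), ℝ), tsupport (u : (EuclideanSpace ℝ (Fin 4)) → ℝ) ⊆ {z | z 0 < 0} ∧ tsupport (v : (EuclideanSpace ℝ (Fin 4)) → ℝ) ⊆ {z | 0 < z 0} ∧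
      S2T T s u v ≠ 0 := by
  by_contra hall
  push Not at hall
  obtain ⟨F, Gt, H, hF, hG, hH, hne⟩ := hT
  apply hne
  have fact : ∀ {u v : 𝓢((EuclideanSpace ℝ (Fin 4)), ℝ)}, tsupport (u : (EuclideanSpace ℝ (Fin 4)) → ℝ) ⊆ {z | z 0 < 0} →
      tsupport (v : (EuclideanSpace ℝ (Fin 4)) → ℝ) ⊆ {z | 0 < z 0} →
        T.schwinger (1 + 1) (fun _ => s) (T2 u v) =
          T.schwinger 1 (fun _ => s) (T1 u) * T.schwinger 1 (fun _ => s) (T1 v) :=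
    fun hu hv => sub_eq_zero.1 (hall _ _ hu hv)
  set φ := toOne (osAdjoint F) with hφ
  set ψ := toOne Gt with hψ
  have huR : tsupport (reTest φ : (EuclideanSpace ℝ (Fin 4)) → ℝ) ⊆ {z | z 0 < 0} :=
    (tsupport_reTest_subset φ).trans (tsupport_toOne_osAdjoint_subset hF)
  have huI : tsupport (imTest φ : (EuclideanSpace ℝ (Fin 4)) → ℝ) ⊆ {z | z 0 < 0} :=
    (tsupport_imTest_subset φ).trans (tsupport_toOne_osAdjoint_subset hF)
  have hvR : tsupport (reTest ψ : (EuclideanSpace ℝ (Fin 4)) → ℝ) ⊆ {z | 0 < z 0} :=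
    (tsupport_reTest_subset ψ).trans (tsupport_toOne_subset hG)
  have hvI : tsupport (imTest ψ : (EuclideanSpace ℝ (Fin 4)) → ℝ) ⊆ {z | 0 < z 0} :=
    (tsupport_imTest_subset ψ).trans (tsupport_toOne_subset hG)
  have e1 : osAdjoint F = T1 (reTest φ) + I • T1 (imTest φ) := by
    ext y
    rw [apply_eq_toOne, add_apply, smul_apply, T1_apply, T1_apply,
      smul_eq_mul, ← reTest_add_imTest_mul_I φ (y 0)]
    ring
  have e2 : Gt = T1 (reTest ψ) + I • T1 (imTest ψ) := by
    ext y
    rw [apply_eq_toOne, add_apply, smul_apply, T1_apply, T1_apply,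
      smul_eq_mul, ← reTest_add_imTest_mul_I ψ (y 0)]
    ring
  have e3 : H = T2 (reTest φ) (reTest ψ) - T2 (imTest φ) (imTest ψ) +
      I • T2 (reTest φ) (imTest ψ) + I • T2 (imTest φ) (reTest ψ) := by
    ext x
    rw [hH x, apply_eq_toOne, apply_eq_toOne Gt]
    simp only [add_apply, sub_apply, smul_apply, T2_apply,
      smul_eq_mul, Function.comp_apply]
    rw [show Fin.castAdd 1 (0 : Fin 1) = (0 : Fin (1 + 1)) from rfl,
      show Fin.natAdd 1 (0 : Fin 1) = (1 : Fin (1 + 1)) from rfl,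
      ← reTest_add_imTest_mul_I φ (x 0), ← reTest_add_imTest_mul_I ψ (x 1)]
    linear_combination ((imTest φ (x 0) : ℂ) * (imTest ψ (x 1) : ℂ)) * Complex.I_sq
  rw [e3, e1, e2]
  simp only [map_add, map_sub, map_smul, smul_eq_mul]
  rw [fact huR hvR, fact huI hvI, fact huR hvI, fact huI hvR]
  linear_combination (-((T.schwinger 1 fun _ => s) (T1 (imTest φ)) *
    (T.schwinger 1 fun _ => s) (T1 (imTest ψ)))) * Complex.I_sq

end Truncated

section Limits

variable {G : Type} [Group G] [TopologicalSpace G] [IsTopologicalGroup G] [CompactSpace G]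
  [MeasurableSpace G] [BorelSpace G]

/-- **The witness's connected two-point function is the limit of `c_k² K_k`.** For OS data tied
to the scheme by `IsYangMillsFor`, on every off-diagonal real product tensor
`c_k² K_{a_k,β_k,L_k}(u, v) → 𝔖₂ᵀ(u ⊗ v)`. [folklore] -/
theorem tendsto_c_sq_mul_kernel (r : LatticeRep G) (sch : SpeciesScheme (YMSpecies G))
    (T : OSData (YMSpecies G) 4) (hT : IsYangMillsFor r sch T) {u v : 𝓢((EuclideanSpace ℝ (Fin 4)), ℝ)}
    (huv : IsOffDiagonal (T2 u v)) :
    Tendsto (fun k => (((sch.c r.curvature k) ^ 2 *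
        twoPointKernel r.ρ (sch.a k) (sch.β k) (sch.L k) u v : ℝ) : ℂ)) atTop
      (𝓝 (S2T T r.curvature u v)) := by
  have h2 := hT (1 + 1) (by norm_num) (fun _ => r.curvature) ![u, v] (T2 u v) (isTensorOf_T2 u v)
    huv
  have hu := hT 1 one_ne_zero (fun _ => r.curvature) ![u] (T1 u) (isTensorOf_T1 u)
    (isOffDiagonal_one _)
  have hv := hT 1 one_ne_zero (fun _ => r.curvature) ![v] (T1 v) (isTensorOf_T1 v)
    (isOffDiagonal_one _)
  refine (h2.sub (hu.mul hv)).congr' (Eventually.of_forall fun k => ?_)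
  rw [← ofReal_mul, ← ofReal_sub, latticeSchwinger_conn_two_eq]

/-- **`c_k ≠ 0` and `K_k(u₀, v₀) ≠ 0` eventually** as soon as `𝔖₂ᵀ(u₀ ⊗ v₀) ≠ 0`. [folklore] -/
theorem eventually_c_ne_zero_and_kernel_ne_zero (r : LatticeRep G) (sch : SpeciesScheme (YMSpecies G))
    (T : OSData (YMSpecies G) 4) (hT : IsYangMillsFor r sch T) {u₀ v₀ : 𝓢((EuclideanSpace ℝ (Fin 4)), ℝ)}
    (h₀ : IsOffDiagonal (T2 u₀ v₀)) (hne : S2T T r.curvature u₀ v₀ ≠ 0) :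
    ∀ᶠ k in atTop, sch.c r.curvature k ≠ 0 ∧
      twoPointKernel r.ρ (sch.a k) (sch.β k) (sch.L k) u₀ v₀ ≠ 0 := by
  have h := (tendsto_c_sq_mul_kernel r sch T hT h₀).eventually (isOpen_ne.mem_nhds hne)
  filter_upwards [h] with k hk
  have hk' : (sch.c r.curvature k) ^ 2 * twoPointKernel r.ρ (sch.a k) (sch.β k) (sch.L k) u₀ v₀ ≠ 0 := by
    intro h0; apply hk; simp only [h0, ofReal_zero]
  exact ⟨fun h0 => hk' (by rw [h0]; ring), fun h0 => hk' (by rw [h0]; ring)⟩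

/-- **Witness-free ratio convergence.** If `𝔖₂ᵀ(u₀ ⊗ v₀) ≠ 0`, the RATIOS of unit-normalised
lattice kernels converge: `K_k(u, v) / K_k(u₀, v₀) → 𝔖₂ᵀ(u ⊗ v) / 𝔖₂ᵀ(u₀ ⊗ v₀)` for every
off-diagonal real pair — a statement about Wilson lattice expectations alone, in which no
renormalisation constant appears. [folklore] -/
theorem tendsto_kernel_ratio (r : LatticeRep G) (sch : SpeciesScheme (YMSpecies G))
    (T : OSData (YMSpecies G) 4) (hT : IsYangMillsFor r sch T) {u₀ v₀ u v : 𝓢((EuclideanSpace ℝ (Fin 4)), ℝ)}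
    (h₀ : IsOffDiagonal (T2 u₀ v₀)) (hne : S2T T r.curvature u₀ v₀ ≠ 0)
    (huv : IsOffDiagonal (T2 u v)) :
    Tendsto (fun k => ((twoPointKernel r.ρ (sch.a k) (sch.β k) (sch.L k) u v /
        twoPointKernel r.ρ (sch.a k) (sch.β k) (sch.L k) u₀ v₀ : ℝ) : ℂ)) atTop
      (𝓝 (S2T T r.curvature u v / S2T T r.curvature u₀ v₀)) := by
  have hA := tendsto_c_sq_mul_kernel r sch T hT huv
  have hB := tendsto_c_sq_mul_kernel r sch T hT h₀
  refine (hA.div hB hne).congr' ?_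
  filter_upwards [eventually_c_ne_zero_and_kernel_ne_zero r sch T hT h₀ hne] with k hk
  rw [Pi.div_apply, ← ofReal_div, mul_div_mul_left _ _ (pow_ne_zero 2 hk.1)]

/-- **Uniqueness of the continuum limit up to scale (two-point sector).** Two OS data tied by
`IsYangMillsFor` to schemes with the SAME bare data `(a, β, L)` (arbitrary, possibly different
renormalisations), the first non-trivial in `tr F²`, have PROPORTIONAL truncated two-point
functions of `tr F²` on all off-diagonal real product tensors: `𝔖'₂ᵀ = ρ · 𝔖₂ᵀ`. The
multiplicative renormalisation is determined up to `o(1)` by the bare sequence; the `∃ T` of the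
crux is secretly "`∃! T` up to field rescaling" on the sector pinned by the lattice. [folklore] -/
theorem truncated_two_unique_up_to_scale (r : LatticeRep G) {sch sch' : SpeciesScheme (YMSpecies G)}
    (ha : sch'.a = sch.a) (hβ : sch'.β = sch.β) (hL : sch'.L = sch.L)
    {T T' : OSData (YMSpecies G) 4} (hT : IsYangMillsFor r sch T) (hT' : IsYangMillsFor r sch' T')
    (hNT : T.IsNontrivial r.curvature) :
    ∃ ρ : ℂ, ∀ u v : 𝓢((EuclideanSpace ℝ (Fin 4)), ℝ), IsOffDiagonal (T2 u v) →
      S2T T' r.curvature u v = ρ * S2T T r.curvature u v := by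
  obtain ⟨u₀, v₀, hu₀, hv₀, hne⟩ := exists_truncated_ne_zero_of_isNontrivial T r.curvature hNT
  have h₀ : IsOffDiagonal (T2 u₀ v₀) := isOffDiagonal_T2 hu₀ hv₀
  refine ⟨S2T T' r.curvature u₀ v₀ / S2T T r.curvature u₀ v₀, fun u v huv => ?_⟩
  have hA' := tendsto_c_sq_mul_kernel r sch' T' hT' huv
  have hB' := tendsto_c_sq_mul_kernel r sch' T' hT' h₀
  have hA := tendsto_c_sq_mul_kernel r sch T hT huv
  have hB := tendsto_c_sq_mul_kernel r sch T hT h₀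
  simp only [ha, hβ, hL] at hA' hB'
  have hlim := hB'.mul (hA.div hB hne)
  have heq : (fun k => (((sch'.c r.curvature k) ^ 2 *
      twoPointKernel r.ρ (sch.a k) (sch.β k) (sch.L k) u v : ℝ) : ℂ)) =ᶠ[atTop]
      fun k => (((sch'.c r.curvature k) ^ 2 *
        twoPointKernel r.ρ (sch.a k) (sch.β k) (sch.L k) u₀ v₀ : ℝ) : ℂ) *
      ((fun k => (((sch.c r.curvature k) ^ 2 *
        twoPointKernel r.ρ (sch.a k) (sch.β k) (sch.L k) u v : ℝ) : ℂ)) /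
       (fun k => (((sch.c r.curvature k) ^ 2 *
        twoPointKernel r.ρ (sch.a k) (sch.β k) (sch.L k) u₀ v₀ : ℝ) : ℂ))) k := by
    filter_upwards [eventually_c_ne_zero_and_kernel_ne_zero r sch T hT h₀ hne] with k hk
    have h1 : (sch.c r.curvature k : ℂ) ≠ 0 := ofReal_ne_zero.2 hk.1
    have h2 : (twoPointKernel r.ρ (sch.a k) (sch.β k) (sch.L k) u₀ v₀ : ℂ) ≠ 0 :=
      ofReal_ne_zero.2 hk.2
    simp only [Pi.div_apply]
    push_cast
    field_simp
  have huniq := tendsto_nhds_unique hA' (hlim.congr' heq.symm)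
  rw [huniq]
  field_simp

/-- If the second datum is non-trivial too, the proportionality constant is nonzero. [folklore] -/
theorem scale_ne_zero (r : LatticeRep G) {T T' : OSData (YMSpecies G) 4} {ρ : ℂ}
    (hρ : ∀ u v : 𝓢((EuclideanSpace ℝ (Fin 4)), ℝ), IsOffDiagonal (T2 u v) → S2T T' r.curvature u v = ρ * S2T T r.curvature u v)
    (hNT' : T'.IsNontrivial r.curvature) : ρ ≠ 0 := by
  obtain ⟨u, v, hu, hv, hne⟩ := exists_truncated_ne_zero_of_isNontrivial T' r.curvature hNT'
  rintro rfl
  exact hne (by rw [hρ u v (isOffDiagonal_T2 hu hv), zero_mul])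

end Limits


end

end Summit.QuantumFields.YangMills.Theorems.ContinuumLimitOnTrajectory.Negative
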